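import Summits.NavierStokesRegularity.FluidComputer.HeadStartPulseFire

/-!
# The head-start gate under a POLYNOMIAL amplitude threshold, part 2: (douse), (atc), `E_*`-dissipation

Companion of `HeadStartPulseFire.lean` (cell `pub-fluidc`, blueprint seat bp1, gen 20; ONE text split by
the 400-line rule; namespace `Summit.NavierStokesRegularity.FluidComputer.HeadStart`). HONEST FRAMING
(verbatim): low prior, high value-of-information experiment on Tao's machine paradigm; NOT a claim that NS
blows up. Five-mode truncation (5.5) of [Tao2016AveragedNS, §5.5] in the retuned form
`delayCircuitWith K M ε` with a diagonal damping `-E(t) * X(t)`, `0 ≤ Eᵢ(t) ≤ η ≤ 1/100`, on `[0,2]`, from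
the signed head-start class `HS±(ε)`; nothing is proved about Navier–Stokes. This is
`HeadStartFire.V_remainder_le`, `HeadStartDouse.e_tenth`, `HeadStartDouse.Es_dissipation` carried VERBATIM
from the window `[t_c + δ, 2]` to a horizon `[t_c + δ, T]`, `T ≤ 2`, with the exponential amplitude
hypothesis `ε² ≤ e^{-18M}/(64M)` replaced by the PULSE HYPOTHESIS (hεT) `64·M·ε²·e^{5M(T - t_c)} ≤ K²⁰`
of part 1 (and `e^{-M} ≤ K⁻¹⁰`): `V_remainder_on` (`|R| ≤ 9K⁻⁹⁰` in `∂ₜV`, `V = adε²/c`), `e_tenth_on`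
((atc): `ã(t_c + δ + 1/K) ≥ 11/100` once `t_c + δ + 1/K ≤ T`), `Es_dissipation_on`
(`∂ₜE_* + (K/10)E_* ≤ 7K⁻⁸⁹` on `[t_c + δ + 1/K, T]`).
[cite: Tao2016AveragedNS, §5.5 Thm 5.3 proof: (douse), (atc), (proof of (beable))]. No named facts; 0 sorry.
-/

noncomputable section

namespace Summit.NavierStokesRegularity.FluidComputer

open Real Set Filter Topology
open Literature.Analysis.FluidPDE.Tao2016AveragedNS
open Literature.Analysis.FluidPDE.Tao2016AveragedNS.Thm53 (monotoneOn_sub_of_le_deriv invSqrt_facts)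
open DampedTransition (hasDerivAt_a hasDerivAt_b hasDerivAt_c hasDerivAt_d hasDerivAt_e hasDerivAt_V
  Es_alg_damped hasDerivAt_Es)

namespace HeadStart

variable {K M ε η τ δ T : ℝ} {E X : ℝ → Fin 5 → ℝ}

/-! ## Equipartition: the corrector `V = a d ε²/c` under damping, on the horizon `T` -/

/-- Size of the remainder in `∂ₜV` on `[τ + δ, T]`: `|R| ≤ 9K⁻⁹⁰`. [cite: Tao2016AveragedNS, §5.5 (douse)] -/
theorem V_remainder_on
    (hX : ∀ t ∈ Icc (0:ℝ) 2, HasDerivAt X (delayCircuitWith K M ε (X t) - E t * X t) t)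
    (hE : ∀ t ∈ Icc (0:ℝ) 2, ∀ i, 0 ≤ E t i ∧ E t i ≤ η)
    (h0 : X 0 0 ^ 2 + X 0 1 ^ 2 = 1 ∧ 0 ≤ X 0 0 ∧ -(1 / 5 * ε) ≤ X 0 1 ∧ X 0 1 ≤ 2 / 5 * ε ∧ X 0 2 = 0 ∧ X 0 3 = 0 ∧ X 0 4 = 0)
    (hε : 0 < ε) (hε1 : ε ≤ 1) (hM0 : 0 < M) (hMK : M ≤ K ^ 10) (hK : 16 ≤ K) (hεK : ε ^ 2 ≤ 1 / (12 * K ^ 20))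
    (hKM : exp (-M) ≤ 1 / K ^ 10) (hη : η ≤ 1 / 100)
    (hδ : 0 ≤ δ) (hon : K ^ 111 ≤ exp (M * δ / 8))
    (hτ1 : 1 ≤ τ) (hτT : τ ≤ T) (hT2 : T ≤ 2)
    (hεT : 64 * M * ε ^ 2 * exp (5 * M * (T - τ)) ≤ K ^ 20)
    (hcτ : ∀ t, 0 ≤ t → t ≤ τ → X t 2 ≤ ε ^ 2 / K ^ 10) (hcτeq : X τ 2 = ε ^ 2 / K ^ 10)
    {t : ℝ} (ht : t ∈ Icc (τ + δ) T) :
    |(-(ε * X t 0 * X t 1 * X t 3 + ε ^ 2 * exp (-M) * X t 0 * X t 2 * X t 3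
            + K * X t 0 * X t 3 * X t 4) * (ε ^ 2 * (X t 2)⁻¹)
          - X t 0 * X t 3 * (ε ^ 2 * (X t 2)⁻¹) *
            ((ε ^ 2 * exp (-M) * X t 0 ^ 2 + ε⁻¹ * M * X t 1 * X t 2) * (X t 2)⁻¹))
          - (E t 0 + E t 3 - E t 2) * (X t 0 * X t 3 * (ε ^ 2 * (X t 2)⁻¹))|
      ≤ 9 / K ^ 90 := by
  have hK0 : 0 < K := by linarith
  have hK1 : 1 ≤ K := by linarith
  have ht02 : t ∈ Icc (0 : ℝ) 2 := ⟨by linarith [ht.1], ht.2.trans hT2⟩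
  have hcl : K ^ 100 * ε ^ 2 ≤ X t 2 :=
    c_large_on hX hE h0 hε hε1 hM0 hMK hK hεK hKM hη hδ hon hτ1 hτT hT2 hεT hcτ hcτeq ht
  have hcpos : 0 < X t 2 := lt_of_lt_of_le (by positivity) hcl
  obtain ⟨hc'0, hc'6⟩ :=
    c_deriv_bounds_on hX hE h0 hε hε1 hM0 hMK hK hεK hKM hη hδ hon hτ1 hτT hT2 hεT hcτ hcτeq ht
  set q : ℝ := ε ^ 2 * (X t 2)⁻¹ with hq
  have hq0 : 0 ≤ q := by positivity
  have hq1 : q ≤ 1 / K ^ 100 := by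
    simp only [hq]
    rw [← div_eq_mul_inv, div_le_div_iff₀ hcpos (by positivity), one_mul]
    linarith
  set c' : ℝ := ε ^ 2 * exp (-M) * X t 0 ^ 2 + ε⁻¹ * M * X t 1 * X t 2 with hc'
  have hrat0 : 0 ≤ c' * (X t 2)⁻¹ := by positivity
  have hrat : c' * (X t 2)⁻¹ ≤ 6 * K ^ 10 := by
    rw [← div_eq_mul_inv, div_le_iff₀ hcpos]; exact hc'6
  have ha : |X t 0| ≤ 1 := traj_abs_le_one hX hE h0 ht02 0
  have hb : |X t 1| ≤ 1 := traj_abs_le_one hX hE h0 ht02 1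
  have hc : |X t 2| ≤ 1 := traj_abs_le_one hX hE h0 ht02 2
  have hd : |X t 3| ≤ 1 := traj_abs_le_one hX hE h0 ht02 3
  have he : |X t 4| ≤ 1 := traj_abs_le_one hX hE h0 ht02 4
  -- term 1
  have hT1 : |(-(ε * X t 0 * X t 1 * X t 3 + ε ^ 2 * exp (-M) * X t 0 * X t 2 * X t 3
      + K * X t 0 * X t 3 * X t 4) * q)| ≤ (2 + K) * (1 / K ^ 100) := by
    rw [abs_mul, abs_neg, abs_of_nonneg hq0]
    have hin : |ε * X t 0 * X t 1 * X t 3 + ε ^ 2 * exp (-M) * X t 0 * X t 2 * X t 3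
        + K * X t 0 * X t 3 * X t 4| ≤ 2 + K := by
      have e1 : |ε * X t 0 * X t 1 * X t 3| ≤ 1 := by
        rw [abs_mul, abs_mul, abs_mul, abs_of_pos hε]
        calc ε * |X t 0| * |X t 1| * |X t 3| ≤ 1 * 1 * 1 * 1 := by gcongr
          _ = 1 := by ring
      have e2 : |ε ^ 2 * exp (-M) * X t 0 * X t 2 * X t 3| ≤ 1 := by
        have hμ1 : ε ^ 2 * exp (-M) ≤ 1 := by
          have hek : exp (-M) ≤ 1 := by rw [exp_le_one_iff, neg_nonpos]; exact hM0.le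
          calc ε ^ 2 * exp (-M) ≤ 1 ^ 2 * 1 :=
                mul_le_mul (pow_le_pow_left₀ hε.le hε1 2) hek (exp_pos _).le (by positivity)
            _ = 1 := by ring
        rw [abs_mul, abs_mul, abs_mul, abs_of_nonneg (by positivity : 0 ≤ ε ^ 2 * exp (-M))]
        calc ε ^ 2 * exp (-M) * |X t 0| * |X t 2| * |X t 3| ≤ 1 * 1 * 1 * 1 := by gcongr
          _ = 1 := by ring
      have e3 : |K * X t 0 * X t 3 * X t 4| ≤ K := by
        rw [abs_mul, abs_mul, abs_mul, abs_of_pos hK0]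
        calc K * |X t 0| * |X t 3| * |X t 4| ≤ K * 1 * 1 * 1 := by gcongr
          _ = K := by ring
      calc _ ≤ |ε * X t 0 * X t 1 * X t 3 + ε ^ 2 * exp (-M) * X t 0 * X t 2 * X t 3|
            + |K * X t 0 * X t 3 * X t 4| := abs_add_le _ _
        _ ≤ |ε * X t 0 * X t 1 * X t 3| + |ε ^ 2 * exp (-M) * X t 0 * X t 2 * X t 3|
            + |K * X t 0 * X t 3 * X t 4| := by
            have := abs_add_le (ε * X t 0 * X t 1 * X t 3)
              (ε ^ 2 * exp (-M) * X t 0 * X t 2 * X t 3)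
            linarith
        _ ≤ 2 + K := by linarith
    exact mul_le_mul hin hq1 hq0 (by positivity)
  -- term 2
  have hT2' : |X t 0 * X t 3 * q * (c' * (X t 2)⁻¹)| ≤ 6 * K ^ 10 * (1 / K ^ 100) := by
    rw [abs_mul, abs_mul, abs_mul, abs_of_nonneg hq0, abs_of_nonneg hrat0]
    calc |X t 0| * |X t 3| * q * (c' * (X t 2)⁻¹) ≤ 1 * 1 * (1 / K ^ 100) * (6 * K ^ 10) := by
          gcongr
      _ = 6 * K ^ 10 * (1 / K ^ 100) := by ring
  -- term 3 (the damping's)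
  have hT3 : |(E t 0 + E t 3 - E t 2) * (X t 0 * X t 3 * q)| ≤ 1 * (1 / K ^ 100) := by
    have hE0 := hE t ht02 0
    have hE2 := hE t ht02 2
    have hE3 := hE t ht02 3
    have hEs : |E t 0 + E t 3 - E t 2| ≤ 1 := by
      rw [abs_le]; constructor <;> linarith [hE0.1, hE0.2, hE2.1, hE2.2, hE3.1, hE3.2]
    rw [abs_mul, abs_mul, abs_mul, abs_of_nonneg hq0]
    calc |E t 0 + E t 3 - E t 2| * (|X t 0| * |X t 3| * q) ≤ 1 * (1 * 1 * (1 / K ^ 100)) := by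
          gcongr
      _ = 1 * (1 / K ^ 100) := by ring
  have hsum : (2 + K) * (1 / K ^ 100) + 6 * K ^ 10 * (1 / K ^ 100) + 1 * (1 / K ^ 100)
      ≤ 9 / K ^ 90 := by
    have h10 : 3 + K ≤ 3 * K ^ 10 := by
      have : K ≤ K ^ 10 := le_self_pow₀ hK1 (by norm_num)
      linarith
    rw [show 9 / K ^ 90 = 9 * K ^ 10 * (1 / K ^ 100) by field_simp]
    have : 0 ≤ 1 / K ^ 100 := by positivity
    nlinarith
  calc _ ≤ |(-(ε * X t 0 * X t 1 * X t 3 + ε ^ 2 * exp (-M) * X t 0 * X t 2 * X t 3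
        + K * X t 0 * X t 3 * X t 4) * q) - X t 0 * X t 3 * q * (c' * (X t 2)⁻¹)|
        + |(E t 0 + E t 3 - E t 2) * (X t 0 * X t 3 * q)| := abs_sub _ _
    _ ≤ (|(-(ε * X t 0 * X t 1 * X t 3 + ε ^ 2 * exp (-M) * X t 0 * X t 2 * X t 3
        + K * X t 0 * X t 3 * X t 4) * q)| + |X t 0 * X t 3 * q * (c' * (X t 2)⁻¹)|)
        + |(E t 0 + E t 3 - E t 2) * (X t 0 * X t 3 * q)| :=
        add_le_add (abs_sub _ _) le_rfl
    _ ≤ (2 + K) * (1 / K ^ 100) + 6 * K ^ 10 * (1 / K ^ 100) + 1 * (1 / K ^ 100) :=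
        add_le_add (add_le_add hT1 hT2') hT3
    _ ≤ 9 / K ^ 90 := hsum

/-! ## (atc) on the horizon `T` -/

/-- **(atc), damped, on the horizon `T`**: `ã(t_c + δ + 1/K) ≥ 11/100` as soon as `t_c + δ + 1/K ≤ T`
(same contradiction argument as `HeadStart.e_tenth`, run on `J = [t_c + δ, t_c + δ + 1/K] ⊆ [t_c + δ, T]`).
[cite: Tao2016AveragedNS, §5.5 (atc)] -/
theorem e_tenth_on
    (hX : ∀ t ∈ Icc (0:ℝ) 2, HasDerivAt X (delayCircuitWith K M ε (X t) - E t * X t) t)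
    (hE : ∀ t ∈ Icc (0:ℝ) 2, ∀ i, 0 ≤ E t i ∧ E t i ≤ η)
    (h0 : X 0 0 ^ 2 + X 0 1 ^ 2 = 1 ∧ 0 ≤ X 0 0 ∧ -(1 / 5 * ε) ≤ X 0 1 ∧ X 0 1 ≤ 2 / 5 * ε ∧ X 0 2 = 0 ∧ X 0 3 = 0 ∧ X 0 4 = 0)
    (hε : 0 < ε) (hε1 : ε ≤ 1) (hM0 : 0 < M) (hMK : M ≤ K ^ 10) (hK : 16 ≤ K) (hεK : ε ^ 2 ≤ 1 / (12 * K ^ 20))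
    (hKM : exp (-M) ≤ 1 / K ^ 10) (hη : η ≤ 1 / 100)
    (hδ : 0 ≤ δ) (hon : K ^ 111 ≤ exp (M * δ / 8))
    (hτ1 : 1 ≤ τ) (hfit : τ + δ + K⁻¹ ≤ T) (hT2 : T ≤ 2)
    (hεT : 64 * M * ε ^ 2 * exp (5 * M * (T - τ)) ≤ K ^ 20)
    (hcτ : ∀ t, 0 ≤ t → t ≤ τ → X t 2 ≤ ε ^ 2 / K ^ 10) (hcτeq : X τ 2 = ε ^ 2 / K ^ 10) :
    11 / 100 ≤ X (τ + δ + K⁻¹) 4 := by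
  have hK0 : 0 < K := by linarith
  have hK1 : 1 ≤ K := by linarith
  have hη0 : 0 ≤ η := (hE 0 ⟨le_rfl, zero_le_two⟩ 0).1.trans (hE 0 ⟨le_rfl, zero_le_two⟩ 0).2
  have hu0' : 0 < K⁻¹ := inv_pos.2 hK0
  have hτT : τ ≤ T := by linarith
  set t₀ : ℝ := τ + δ with ht₀
  set t₁ : ℝ := τ + δ + K⁻¹ with ht₁
  have ht₀0 : 0 ≤ t₀ := by simp only [ht₀]; linarith
  have h01 : t₀ ≤ t₁ := by simp only [ht₀, ht₁]; linarith
  have ht1T : t₁ ≤ T := hfit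
  have ht12 : t₁ ≤ 2 := ht1T.trans hT2
  have ht₁02 : t₁ ∈ Icc (0:ℝ) 2 := ⟨by linarith, ht12⟩
  have hJI : ∀ s ∈ Icc t₀ t₁, s ∈ Icc (τ + δ) T := fun s hs => ⟨hs.1, hs.2.trans ht1T⟩
  have hK20 : (2 : ℝ) ^ 20 ≤ K ^ 20 := pow_le_pow_left₀ (by norm_num) (by linarith) 20
  have hK90 : (2 : ℝ) ^ 90 ≤ K ^ 90 := pow_le_pow_left₀ (by norm_num) (by linarith) 90
  have hε2 : (5 * ε) ^ 2 ≤ 1 / 1000 := by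
    have h6 : 1 / (12 * K ^ 20) ≤ 1 / 25000 := by
      apply one_div_le_one_div_of_le (by norm_num); linarith
    have : (5 * ε) ^ 2 = 25 * ε ^ 2 := by ring
    rw [this]; linarith
  have hK90' : 9 / K ^ 90 ≤ 1 / 1000 := by
    rw [div_le_div_iff₀ (by positivity) (by norm_num)]; linarith
  by_contra hlt'
  have hlt := not_le.1 hlt'
  have hmonoE := output_mul_exp_monotoneOn hX hE h0 hK0.le
  have hes : ∀ s ∈ Icc t₀ t₁, X s 4 ≤ 3 / 25 := by
    intro s hs
    have hs02 : s ∈ Icc (0:ℝ) 2 := ⟨by linarith [hs.1], (hJI s hs).2.trans hT2⟩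
    have hm := hmonoE hs02 ht₁02 hs.2
    simp only at hm
    have hx0 : 0 ≤ η * (t₁ - s) := mul_nonneg hη0 (by linarith [hs.2])
    have hx1 : η * (t₁ - s) ≤ 1 / 50 := by
      calc η * (t₁ - s) ≤ 1 / 100 * 2 := mul_le_mul hη (by linarith [hs02.1]) (by linarith [hs.2])
            (by norm_num)
        _ = 1 / 50 := by norm_num
    have hex : exp (η * (t₁ - s)) ≤ 50 / 49 := by
      calc exp (η * (t₁ - s)) ≤ 1 / (1 - η * (t₁ - s)) :=
            Real.exp_bound_div_one_sub_of_interval hx0 (by linarith)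
        _ ≤ 50 / 49 := by rw [div_le_div_iff₀ (by linarith) (by norm_num)]; linarith
    have h2 : exp (η * t₁) = exp (η * s) * exp (η * (t₁ - s)) := by rw [← exp_add]; ring_nf
    have h3 : X t₁ 4 * exp (η * t₁) ≤ 11 / 100 * (exp (η * s) * (50 / 49)) := by
      rw [h2]
      calc X t₁ 4 * (exp (η * s) * exp (η * (t₁ - s)))
          ≤ 11 / 100 * (exp (η * s) * exp (η * (t₁ - s))) :=
            mul_le_mul_of_nonneg_right hlt.le (by positivity)
        _ ≤ 11 / 100 * (exp (η * s) * (50 / 49)) :=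
            mul_le_mul_of_nonneg_left (mul_le_mul_of_nonneg_left hex (exp_pos _).le) (by norm_num)
    have h4 : X s 4 * exp (η * s) ≤ 3 / 25 * exp (η * s) := by linarith [exp_pos (η * s)]
    exact le_of_mul_le_mul_right h4 (exp_pos _)
  have hmono := monotoneOn_sub_of_le_deriv (φ := fun _ => (93 : ℝ) / 100)
    (Φ := fun s => 93 / 100 * s) (convex_Icc t₀ t₁)
    (f := fun s => X s 0 * X s 3 * (ε ^ 2 * (X s 2)⁻¹) + 2 / K * X s 4)
    (fun s hs => by
      have hsI := hJI s hs
      have hs02 : s ∈ Icc (0:ℝ) 2 := ⟨by linarith [hs.1], hsI.2.trans hT2⟩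
      have hcl : K ^ 100 * ε ^ 2 ≤ X s 2 :=
        c_large_on hX hE h0 hε hε1 hM0 hMK hK hεK hKM hη hδ hon hτ1 hτT hT2 hεT hcτ hcτeq hsI
      have hcne : X s 2 ≠ 0 := (lt_of_lt_of_le (by positivity) hcl).ne'
      exact (hasDerivAt_V (hX s hs02) hε.ne' hcne).add ((hasDerivAt_e (hX s hs02)).const_mul (2 / K)))
    (fun s _ => ((hasDerivAt_id s).const_mul ((93 : ℝ) / 100)).congr_deriv (by simp))
    (fun s hs => by
      have hsI := hJI s hs
      have hs02 : s ∈ Icc (0 : ℝ) 2 := ⟨by linarith [hs.1, ht₀0], hsI.2.trans hT2⟩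
      have hR := V_remainder_on hX hE h0 hε hε1 hM0 hMK hK hεK hKM hη hδ hon hτ1 hτT hT2 hεT hcτ
        hcτeq hsI
      have hRlo := (abs_le.1 hR).1
      obtain ⟨hSlo, -⟩ := sum_sq_sandwich hX hE h0 hs02
      have hS96 : 24 / 25 ≤ X s 0 ^ 2 + X s 1 ^ 2 + X s 2 ^ 2 + X s 3 ^ 2 + X s 4 ^ 2 := by
        have : 2 * η * s ≤ 2 * (1 / 100) * 2 :=
          mul_le_mul (mul_le_mul_of_nonneg_left hη (by norm_num)) hs02.2 hs02.1 (by norm_num)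
        linarith
      obtain ⟨hb5, hc5⟩ := bc_small hX hE h0 hε hε1 hM0.le hs02
      have hb2 : X s 1 ^ 2 ≤ (5 * ε) ^ 2 := by
        rw [← sq_abs]; exact pow_le_pow_left₀ (abs_nonneg _) hb5 2
      have hc2 : X s 2 ^ 2 ≤ (5 * ε) ^ 2 := by
        rw [← sq_abs]; exact pow_le_pow_left₀ (abs_nonneg _) hc5 2
      have hes0 : 0 ≤ X s 4 := e_nonneg hX hE h0 hK0.le hs02
      have he2 : X s 4 ^ 2 ≤ (3 / 25) ^ 2 := pow_le_pow_left₀ hes0 (hes s hs) 2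
      have hE4 := hE s hs02 4
      have he1 : X s 4 ≤ 1 := (le_abs_self _).trans (traj_abs_le_one hX hE h0 hs02 4)
      have hp : E s 4 * X s 4 ≤ 1 / 100 := by
        calc E s 4 * X s 4 ≤ η * 1 := mul_le_mul hE4.2 he1 hes0 hη0
          _ ≤ 1 / 100 := by linarith
      have hp0 : 0 ≤ E s 4 * X s 4 := mul_nonneg hE4.1 hes0
      have h2K : 2 / K ≤ 1 / 8 := by rw [div_le_iff₀ hK0]; linarith
      have hEe : 2 / K * (E s 4 * X s 4) ≤ 1 / 8 * (1 / 100) := mul_le_mul h2K hp hp0 (by norm_num)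
      have hKd : 2 / K * (K * X s 3 ^ 2 - E s 4 * X s 4) = 2 * X s 3 ^ 2 - 2 / K * (E s 4 * X s 4) := by
        have : (2:ℝ) / K * K = 2 := div_mul_cancel₀ 2 hK0.ne'
        rw [mul_sub, ← mul_assoc, this]
      rw [hKd]
      norm_num at he2 ⊢
      linarith)
  have hmem0 : t₀ ∈ Icc t₀ t₁ := ⟨le_rfl, h01⟩
  have hmem1 : t₁ ∈ Icc t₀ t₁ := ⟨h01, le_rfl⟩
  have h := hmono hmem0 hmem1 h01
  simp only at h
  have hV : ∀ s ∈ Icc t₀ t₁, |X s 0 * X s 3 * (ε ^ 2 * (X s 2)⁻¹)| ≤ 1 / K ^ 100 := by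
    intro s hs
    have hsI := hJI s hs
    have hs02 : s ∈ Icc (0:ℝ) 2 := ⟨by linarith [hs.1], hsI.2.trans hT2⟩
    have hcl : K ^ 100 * ε ^ 2 ≤ X s 2 :=
      c_large_on hX hE h0 hε hε1 hM0 hMK hK hεK hKM hη hδ hon hτ1 hτT hT2 hεT hcτ hcτeq hsI
    have hcpos : 0 < X s 2 := lt_of_lt_of_le (by positivity) hcl
    have hq0 : 0 ≤ ε ^ 2 * (X s 2)⁻¹ := by positivity
    have hq : ε ^ 2 * (X s 2)⁻¹ ≤ 1 / K ^ 100 := by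
      rw [← div_eq_mul_inv, div_le_div_iff₀ hcpos (by positivity), one_mul]; linarith
    rw [abs_mul, abs_mul, abs_of_nonneg hq0]
    calc |X s 0| * |X s 3| * (ε ^ 2 * (X s 2)⁻¹) ≤ 1 * 1 * (1 / K ^ 100) :=
          mul_le_mul (mul_le_mul (traj_abs_le_one hX hE h0 hs02 0) (traj_abs_le_one hX hE h0 hs02 3)
            (abs_nonneg _) zero_le_one) hq hq0 (by norm_num)
      _ = 1 / K ^ 100 := by ring
  have hV0 := (abs_le.1 (hV t₀ hmem0)).1
  have hV1 := (abs_le.1 (hV t₁ hmem1)).2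
  have he0 : 0 ≤ X t₀ 4 := e_nonneg hX hE h0 hK0.le ⟨ht₀0, h01.trans ht12⟩
  have hlen : t₁ - t₀ = K⁻¹ := by simp only [ht₀, ht₁]; ring
  set u : ℝ := K⁻¹ with hu
  have hu0 : 0 < u := by positivity
  have hK8 : (2 : ℝ) ^ 8 ≤ K ^ 8 := pow_le_pow_left₀ (by norm_num) (by linarith) 8
  have hK99 : (2 : ℝ) ^ 8 ≤ K ^ 99 := hK8.trans (pow_le_pow_right₀ hK1 (by norm_num))
  have hi99 : (K ^ 99)⁻¹ ≤ 1 / 256 := by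
    rw [one_div, inv_le_inv₀ (by positivity) (by norm_num)]; linarith
  have h100 : 1 / K ^ 100 ≤ u * (1 / 256) := by
    rw [show 1 / K ^ 100 = u * (K ^ 99)⁻¹ by
      simp only [hu]; rw [← mul_inv, ← pow_succ', one_div]]
    exact mul_le_mul_of_nonneg_left hi99 hu0.le
  have hKu : 2 / K * X t₁ 4 - 2 / K * X t₀ 4 ≤ 2 * u * (11 / 100) := by
    have : 2 / K * X t₁ 4 - 2 / K * X t₀ 4 = 2 * u * (X t₁ 4 - X t₀ 4) := by
      simp only [hu]; ring
    rw [this]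
    exact mul_le_mul_of_nonneg_left (by linarith) (by positivity)
  have hfin : 93 / 100 * (t₁ - t₀) ≤ 2 * (u * (1 / 256)) + 2 * u * (11 / 100) := by linarith
  rw [hlen] at hfin
  linarith

/-! ## The modified energy `E_* = ½(a² + b² + c² + d²) - ½K·V·ã`: dissipation on `[t_c + δ + 1/K, T]` -/

/-- **Dissipation inequality for `E_*` under damping** on `[t', T]`, `t' = t_c + δ + 1/K`:
`∂ₜE_* + (K/10)E_* ≤ 7K⁻⁸⁹` (`ã ≥ 1/10` there, from (atc) and `ã(s) ≥ e^{-η(s-t')}ã(t')`).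
[cite: Tao2016AveragedNS, §5.5 (proof of (beable))] -/
theorem Es_dissipation_on
    (hX : ∀ t ∈ Icc (0:ℝ) 2, HasDerivAt X (delayCircuitWith K M ε (X t) - E t * X t) t)
    (hE : ∀ t ∈ Icc (0:ℝ) 2, ∀ i, 0 ≤ E t i ∧ E t i ≤ η)
    (h0 : X 0 0 ^ 2 + X 0 1 ^ 2 = 1 ∧ 0 ≤ X 0 0 ∧ -(1 / 5 * ε) ≤ X 0 1 ∧ X 0 1 ≤ 2 / 5 * ε ∧ X 0 2 = 0 ∧ X 0 3 = 0 ∧ X 0 4 = 0)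
    (hε : 0 < ε) (hε1 : ε ≤ 1) (hM0 : 0 < M) (hMK : M ≤ K ^ 10) (hK : 16 ≤ K) (hεK : ε ^ 2 ≤ 1 / (12 * K ^ 20))
    (hε100 : ε ≤ 1 / K ^ 100) (hKM : exp (-M) ≤ 1 / K ^ 10) (hη : η ≤ 1 / 100)
    (hδ : 0 ≤ δ) (hon : K ^ 111 ≤ exp (M * δ / 8))
    (hτ1 : 1 ≤ τ) (hfit : τ + δ + K⁻¹ ≤ T) (hT2 : T ≤ 2)
    (hεT : 64 * M * ε ^ 2 * exp (5 * M * (T - τ)) ≤ K ^ 20)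
    (hcτ : ∀ t, 0 ≤ t → t ≤ τ → X t 2 ≤ ε ^ 2 / K ^ 10) (hcτeq : X τ 2 = ε ^ 2 / K ^ 10)
    {s : ℝ} (hs : s ∈ Icc (τ + δ + K⁻¹) T) :
    (-(K * X s 4 * X s 3 ^ 2)
        - (E s 0 * X s 0 ^ 2 + E s 1 * X s 1 ^ 2 + E s 2 * X s 2 ^ 2 + E s 3 * X s 3 ^ 2)
        - K / 2 * (((X s 0 ^ 2 - X s 3 ^ 2) +
            ((-(ε * X s 0 * X s 1 * X s 3 + ε ^ 2 * exp (-M) * X s 0 * X s 2 * X s 3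
                + K * X s 0 * X s 3 * X s 4) * (ε ^ 2 * (X s 2)⁻¹)
              - X s 0 * X s 3 * (ε ^ 2 * (X s 2)⁻¹) *
                ((ε ^ 2 * exp (-M) * X s 0 ^ 2 + ε⁻¹ * M * X s 1 * X s 2) * (X s 2)⁻¹))
              - (E s 0 + E s 3 - E s 2) * (X s 0 * X s 3 * (ε ^ 2 * (X s 2)⁻¹)))) * X s 4
          + X s 0 * X s 3 * (ε ^ 2 * (X s 2)⁻¹) * (K * X s 3 ^ 2 - E s 4 * X s 4)))
      + K / 10 * ((X s 0 ^ 2 + X s 1 ^ 2 + X s 2 ^ 2 + X s 3 ^ 2) / 2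
        - K / 2 * (X s 0 * X s 3 * (ε ^ 2 * (X s 2)⁻¹) * X s 4)) ≤ 7 / K ^ 89 := by
  have hK0 : 0 < K := by linarith
  have hK1 : 1 ≤ K := by linarith
  have hη0 : 0 ≤ η := (hE 0 ⟨le_rfl, zero_le_two⟩ 0).1.trans (hE 0 ⟨le_rfl, zero_le_two⟩ 0).2
  have hu0' : 0 < K⁻¹ := inv_pos.2 hK0
  have hτT : τ ≤ T := by linarith
  have hsI : s ∈ Icc (τ + δ) T := ⟨by linarith [hs.1], hs.2⟩
  have hs02 : s ∈ Icc (0 : ℝ) 2 := ⟨by linarith [hs.1], hs.2.trans hT2⟩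
  have ht'02 : τ + δ + K⁻¹ ∈ Icc (0 : ℝ) 2 := ⟨by linarith, hfit.trans hT2⟩
  have hcl : K ^ 100 * ε ^ 2 ≤ X s 2 :=
    c_large_on hX hE h0 hε hε1 hM0 hMK hK hεK hKM hη hδ hon hτ1 hτT hT2 hεT hcτ hcτeq hsI
  have hcpos : 0 < X s 2 := lt_of_lt_of_le (by positivity) hcl
  have hq0 : 0 ≤ ε ^ 2 * (X s 2)⁻¹ := by positivity
  have hq1 : ε ^ 2 * (X s 2)⁻¹ ≤ 1 / K ^ 100 := by
    rw [← div_eq_mul_inv, div_le_div_iff₀ hcpos (by positivity), one_mul]; linarith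
  obtain ⟨hb5, hc5⟩ := bc_small hX hE h0 hε hε1 hM0.le hs02
  have hb2 : X s 1 ^ 2 ≤ (5 * ε) ^ 2 := by
    rw [← sq_abs]; exact pow_le_pow_left₀ (abs_nonneg _) hb5 2
  have hc2 : X s 2 ^ 2 ≤ (5 * ε) ^ 2 := by
    rw [← sq_abs]; exact pow_le_pow_left₀ (abs_nonneg _) hc5 2
  -- `ã(s) ≥ 1/10`
  have he₀ : 11 / 100 ≤ X (τ + δ + K⁻¹) 4 :=
    e_tenth_on hX hE h0 hε hε1 hM0 hMK hK hεK hKM hη hδ hon hτ1 hfit hT2 hεT hcτ hcτeq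
  have hes : 1 / 10 ≤ X s 4 := by
    have hm := output_mul_exp_monotoneOn hX hE h0 hK0.le ht'02 hs02 hs.1
    simp only at hm
    have hx0 : 0 ≤ η * (s - (τ + δ + K⁻¹)) := mul_nonneg hη0 (by linarith [hs.1])
    have hx1 : η * (s - (τ + δ + K⁻¹)) ≤ 1 / 50 := by
      calc η * (s - (τ + δ + K⁻¹)) ≤ 1 / 100 * 2 :=
            mul_le_mul hη (by linarith [ht'02.1, hs02.2]) (by linarith [hs.1]) (by norm_num)
        _ = 1 / 50 := by norm_num
    have hex : 49 / 50 ≤ exp (-(η * (s - (τ + δ + K⁻¹)))) := by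
      have := add_one_le_exp (-(η * (s - (τ + δ + K⁻¹)))); linarith
    have h2 : exp (η * (τ + δ + K⁻¹)) = exp (η * s) * exp (-(η * (s - (τ + δ + K⁻¹)))) := by
      rw [← exp_add]; ring_nf
    rw [h2] at hm
    have h3 : 11 / 100 * (exp (η * s) * (49 / 50)) ≤ X s 4 * exp (η * s) :=
      calc 11 / 100 * (exp (η * s) * (49 / 50))
          ≤ X (τ + δ + K⁻¹) 4 * (exp (η * s) * exp (-(η * (s - (τ + δ + K⁻¹))))) :=
            mul_le_mul he₀ (mul_le_mul_of_nonneg_left hex (exp_pos _).le) (by positivity)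
              (by linarith)
        _ ≤ X s 4 * exp (η * s) := hm
    have h4 : 1 / 10 * exp (η * s) ≤ X s 4 * exp (η * s) := by linarith [exp_pos (η * s)]
    exact le_of_mul_le_mul_right h4 (exp_pos _)
  have hD : 0 ≤ E s 0 * X s 0 ^ 2 + E s 1 * X s 1 ^ 2 + E s 2 * X s 2 ^ 2 + E s 3 * X s 3 ^ 2 := by
    have h0' := (hE s hs02 0).1; have h1' := (hE s hs02 1).1
    have h2' := (hE s hs02 2).1; have h3' := (hE s hs02 3).1
    positivity
  have hE4 := hE s hs02 4
  have halg := Es_alg_damped hK hq0 hq1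
    (V_remainder_on hX hE h0 hε hε1 hM0 hMK hK hεK hKM hη hδ hon hτ1 hτT hT2 hεT hcτ hcτeq hsI)
    (traj_abs_le_one hX hE h0 hs02 0) (traj_abs_le_one hX hE h0 hs02 3) (traj_abs_le_one hX hE h0 hs02 4)
    hes hb2 hc2 hε hε100 hD hE4.1 (hE4.2.trans hη)
  linarith [halg]

end HeadStart
end Summit.NavierStokesRegularity.FluidComputer
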